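import Mathlib
import Summits.NavierStokesRegularity.FluidComputer.TransportGalerkinEigenFourier
import HarnessLib

/-!
# The transport Galerkin model IS the Fourier–Leray image of the Navier–Stokes perturbation operator (instab g20, cell `ns-blowup`, 2026-08-27)

HONEST FRAMING (human ruling D-0035): nothing here is a claim about Navier–Stokes blow-up.
WHAT THIS IS NOT: not NS evidence — a DICTIONARY between the lattice model of the R-β chain
(`TransportGalerkin.linCoeff` / `bilCoeff` / `lerayCLM`, `HOME/instab/BETA2-SPEC.md` §1–§3) and the
classical differential expressions on `𝕋³` of the tree's torus calculus
(`Literature.Analysis.FunctionSpaces.Torus.*`, `Literature.Analysis.FluidPDE.LinearizedNSTorus`);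
no flow, certificate, number or census word moves.

PURPOSE. The KEEP/KILL theorems of the chain are stated for the lattice ODE `w' = nsField (w)` on the
`H²`-scaled coefficient space. For a reader who asks «is this the Navier–Stokes perturbation equation
about the host?», this file records, with the tree's own Fourier dictionary
(`SteadyLattice.mFourierCoeff_convect_complex` / `mFourierCoeff_stretch` / `mFourierCoeff_gradientC`,
`Torus.mFourierCoeff_laplacian`, `TransportGalerkinEigenFourier.linCoeff_proj_apply`):

* `bilCoeff_proj_apply` — the model's bilinearity through `proj` is minus the convective symbol:
  `bilCoeff proj a b (k) = −N(a, b)(k)`, `N(a, b)(k)_p = transportSym (j m ↦ a m j) (m ↦ b m p) k`;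
* `field_proj_eq_mFourierCoeff` — for SMOOTH REAL fields `U` (host) and `u` (perturbation) on `𝕋³`,
  mode by mode,
  `linCoeff ν Û proj û (k) + bilCoeff proj û û (k) = 𝓕[ νΔu − (U·∇)u − (u·∇)U − (u·∇)u ](k)`
  (`Û = 𝓕(U)`, `û = 𝓕(u)`, complexified);
* `leray_field_eq_mFourierCoeff` — through the Leray symbol, for ANY smooth pressure `q`,
  `Π_k (linCoeff + bilCoeff)(k) = Π_k 𝓕[ νΔu − (U·∇)u − (u·∇)U − (u·∇)u − ∇q ](k)` (`Π_k k = 0`).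

So the unscaled field of the model at the coefficients of `u` is EXACTLY the Leray-projected Fourier
transform of the classical perturbation expression of `∂ₜ(U + u) + ((U+u)·∇)(U+u) + ∇p = νΔ(U+u) + f`
about a steady state `U` of `NS_ν(f)` (the host terms cancel against the steady equation, the pressure
against `Π_k`): a classical solution of the perturbed system has coefficients driven by `nsField`
(modulo the `Λ²` scaling of `TransportGalerkinDefs`). The time-dependent transfer (differentiating the
coefficients of a classical solution in `t` inside `E`) is NOT done here. `d = 3`; Mathlib + the tree
files cited; no new definitions.
-/

noncomputable section

namespace Summit.NavierStokesRegularity.FluidComputer.TransportGalerkinFourierDictionary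

open Set Filter Topology Finset MeasureTheory UnitAddTorus
open Literature.Analysis.FunctionSpaces Literature.Analysis.FunctionSpaces.Lattice
open Literature.Analysis.FunctionSpaces.Torus Literature.Analysis.FunctionSpaces.EuclideanSpace
open Literature.Analysis.ODE
open Literature.Analysis.FluidPDE Literature.Analysis.FluidPDE.ScalarFourier
open Literature.Analysis.FluidPDE.SteadyLattice
open Summit.NavierStokesRegularity.FluidComputer.GalerkinLatticePhaseSpace
open Summit.NavierStokesRegularity.FluidComputer.TransportGalerkin
open Summit.NavierStokesRegularity.FluidComputer.TransportGalerkinRapid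
open Summit.NavierStokesRegularity.FluidComputer.TransportGalerkinAbc
open Summit.NavierStokesRegularity.FluidComputer.TransportGalerkinEigen
open Summit.NavierStokesRegularity.FluidComputer.TransportGalerkinEigenFourier
open scoped ENNReal NNReal ComplexConjugate InnerProductSpace

/-! ## §1 The bilinearity through `proj` is minus the convective symbol -/

section Bilinear

variable {d : Type*} [Fintype d] [DecidableEq d]

omit [DecidableEq d] in
/-- **`bilCoeff proj a b (k) = −N(a, b)(k)`** for rapidly decreasing families (`V = ℂ^d`,
`π_j = proj j`): the model's bilinearity is minus the convective symbol of `SteadyLattice`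
(`transportSym`), mode by mode. -/
theorem bilCoeff_proj_apply {a b : (d → ℤ) → EuclideanSpace ℂ d} (ha : RapidDecay a) (hb : RapidDecay b)
    (k : d → ℤ) :
    bilCoeff (fun j => (EuclideanSpace.proj j : EuclideanSpace ℂ d →L[ℂ] ℂ)) a b k =
      -(WithLp.toLp 2 (fun p : d => transportSym (fun j m => a m j) (fun m => b m p) k) : EuclideanSpace ℂ d) := by
  have h : (∑ j, conv (scal (fun q => (EuclideanSpace.proj j : EuclideanSpace ℂ d →L[ℂ] ℂ) (a q)) :
      (d → ℤ) → (EuclideanSpace ℂ d →L[ℂ] EuclideanSpace ℂ d)) (freqDeriv j b)) k =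
      (WithLp.toLp 2 (fun p : d => transportSym (fun j m => a m j) (fun m => b m p) k) : EuclideanSpace ℂ d) := by
    ext p
    rw [PiLp.toLp_apply]
    exact apply_sum_conv_scal_freqDeriv (y := fun j m => a m j) (fun j => exists_bound_proj_comp ha j)
      (summable_norm_freqDeriv hb) k p
  rw [bilCoeff_eq, Pi.neg_apply, h]

end Bilinear

/-! ## §2 The full field is the Fourier transform of the classical perturbation expression -/

section Dictionary

/-- **The model's field at the coefficients of a smooth real perturbation IS the Fourier transform of
the classical perturbation expression** (`field_proj_eq_mFourierCoeff`). For smooth real `U`, `u` on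
`𝕋³`, with `Û = 𝓕(U)`, `û = 𝓕(u)` (complexified) and every mode `k`:
`linCoeff ν Û proj û (k) + bilCoeff proj û û (k) = 𝓕[ νΔu − ((U·∇)u + (u·∇)U) − (u·∇)u ](k)`. -/
theorem field_proj_eq_mFourierCoeff {ν : ℝ} {U u : UnitAddTorus (Fin 3) → EuclideanSpace ℝ (Fin 3)}
    (hU : IsSmooth U) (hu : IsSmooth u) (k : Fin 3 → ℤ) :
    linCoeff ν (mFourierCoeff (complexify ∘ U)) (fun j => (EuclideanSpace.proj j : EuclideanSpace ℂ (Fin 3) →L[ℂ] ℂ))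
        (mFourierCoeff (complexify ∘ u)) k +
      bilCoeff (fun j => (EuclideanSpace.proj j : EuclideanSpace ℂ (Fin 3) →L[ℂ] ℂ))
        (mFourierCoeff (complexify ∘ u)) (mFourierCoeff (complexify ∘ u)) k =
    mFourierCoeff (fun y => (ν : ℂ) • laplacian (complexify ∘ u) y
        - (Torus.convect U (complexify ∘ u) y + Torus.stretch (complexify ∘ u) U y)
        - Torus.convect u (complexify ∘ u) y) k := by
  have hws : IsSmooth (complexify ∘ u) := hu.complexify_comp
  have hUr : RapidDecay (mFourierCoeff (complexify ∘ U)) := hU.complexify_comp.rapidDecay_mFourierCoeff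
  have hwr : RapidDecay (mFourierCoeff (complexify ∘ u)) := hws.rapidDecay_mFourierCoeff
  rw [linCoeff_proj_apply hUr hwr k, bilCoeff_proj_apply hwr hwr k]
  -- the right-hand side, term by term
  have i1 : Integrable (fun y => laplacian (complexify ∘ u) y) volume := hws.laplacian.integrable
  have i1' : Integrable ((ν : ℂ) • fun y => laplacian (complexify ∘ u) y) volume := i1.smul (ν : ℂ)
  have i2 : Integrable (Torus.convect U (complexify ∘ u)) volume := (hU.convect hws).integrable
  have i3 : Integrable (Torus.stretch (complexify ∘ u) U) volume := (isSmooth_stretch hU hws).integrable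
  have i4 : Integrable (Torus.convect u (complexify ∘ u)) volume := (hu.convect hws).integrable
  have hfun : (fun y => (ν : ℂ) • laplacian (complexify ∘ u) y
      - (Torus.convect U (complexify ∘ u) y + Torus.stretch (complexify ∘ u) U y)
      - Torus.convect u (complexify ∘ u) y) =
      ((ν : ℂ) • fun y => laplacian (complexify ∘ u) y) -
        (Torus.convect U (complexify ∘ u) + Torus.stretch (complexify ∘ u) U) - Torus.convect u (complexify ∘ u) := by
    funext y; simp only [Pi.sub_apply, Pi.add_apply, Pi.smul_apply]
  rw [hfun, mFourierCoeff_sub (i1'.sub (i2.add i3)) i4, mFourierCoeff_sub i1' (i2.add i3), mFourierCoeff_add i2 i3,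
    mFourierCoeff_const_smul, show (fun y => laplacian (complexify ∘ u) y) = laplacian (complexify ∘ u) from rfl,
    Torus.mFourierCoeff_laplacian hws k, mFourierCoeff_convect_complex hU hws k, mFourierCoeff_stretch hU hws k,
    mFourierCoeff_convect_complex hu hws k]
  push_cast
  rw [smul_neg, smul_smul]
  abel

/-- **Through the Leray symbol, with ANY smooth pressure** (`leray_field_eq_mFourierCoeff`):
`Π_k (linCoeff ν Û proj û + bilCoeff proj û û)(k) = Π_k 𝓕[ νΔu − ((U·∇)u + (u·∇)U) − (u·∇)u − ∇q ](k)`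
for every smooth `q : 𝕋³ → ℂ` — the pressure gradient has coefficients along `k` and `Π_k k = 0`
(`SteadyLattice.mFourierCoeff_gradientC`, `lerayCoeff_freqVec`). With `P = lerayCLM` this left-hand
side is the unscaled family of `TransportGalerkin.nsField` at `x = Λ² û`
(`TransportGalerkinRapid.coe_linOp_of_rapidDecay` / `coe_bilOp_of_rapidDecay`). -/
theorem leray_field_eq_mFourierCoeff {ν : ℝ} {U u : UnitAddTorus (Fin 3) → EuclideanSpace ℝ (Fin 3)}
    (hU : IsSmooth U) (hu : IsSmooth u) {q : UnitAddTorus (Fin 3) → ℂ} (hq : IsSmooth q) (k : Fin 3 → ℤ) :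
    lerayCLM k
        (linCoeff ν (mFourierCoeff (complexify ∘ U)) (fun j => (EuclideanSpace.proj j : EuclideanSpace ℂ (Fin 3) →L[ℂ] ℂ))
            (mFourierCoeff (complexify ∘ u)) k +
          bilCoeff (fun j => (EuclideanSpace.proj j : EuclideanSpace ℂ (Fin 3) →L[ℂ] ℂ))
            (mFourierCoeff (complexify ∘ u)) (mFourierCoeff (complexify ∘ u)) k) =
      lerayCLM k (mFourierCoeff (fun y => (ν : ℂ) • laplacian (complexify ∘ u) y
        - (Torus.convect U (complexify ∘ u) y + Torus.stretch (complexify ∘ u) U y)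
        - Torus.convect u (complexify ∘ u) y - Torus.gradientC q y) k) := by
  have hws : IsSmooth (complexify ∘ u) := hu.complexify_comp
  rw [field_proj_eq_mFourierCoeff hU hu k]
  -- split off the pressure gradient
  have i1 : Integrable (fun y => laplacian (complexify ∘ u) y) volume := hws.laplacian.integrable
  have i1' : Integrable ((ν : ℂ) • fun y => laplacian (complexify ∘ u) y) volume := i1.smul (ν : ℂ)
  have i2 : Integrable (Torus.convect U (complexify ∘ u)) volume := (hU.convect hws).integrable
  have i3 : Integrable (Torus.stretch (complexify ∘ u) U) volume := (isSmooth_stretch hU hws).integrable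
  have i4 : Integrable (Torus.convect u (complexify ∘ u)) volume := (hu.convect hws).integrable
  have c5 : Continuous fun y => Torus.gradientC q y :=
    (PiLp.continuous_toLp 2 _).comp (continuous_pi fun l => (hq.partialDeriv l).continuous)
  have i5 : Integrable (Torus.gradientC q) volume := Continuous.integrable_unitAddTorus c5
  have hF : Integrable (fun y => (ν : ℂ) • laplacian (complexify ∘ u) y
      - (Torus.convect U (complexify ∘ u) y + Torus.stretch (complexify ∘ u) U y)
      - Torus.convect u (complexify ∘ u) y) volume := by
    have h := (i1'.sub (i2.add i3)).sub i4
    refine h.congr (Filter.Eventually.of_forall fun y => ?_)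
    simp only [Pi.sub_apply, Pi.add_apply, Pi.smul_apply]
  have hfun : (fun y => (ν : ℂ) • laplacian (complexify ∘ u) y
      - (Torus.convect U (complexify ∘ u) y + Torus.stretch (complexify ∘ u) U y)
      - Torus.convect u (complexify ∘ u) y - Torus.gradientC q y) =
      (fun y => (ν : ℂ) • laplacian (complexify ∘ u) y
        - (Torus.convect U (complexify ∘ u) y + Torus.stretch (complexify ∘ u) U y)
        - Torus.convect u (complexify ∘ u) y) - Torus.gradientC q := by
    funext y; simp only [Pi.sub_apply]
  rw [hfun, mFourierCoeff_sub hF i5, map_sub, mFourierCoeff_gradientC hq k, map_smul, lerayCLM_apply,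
    lerayCLM_apply, lerayCoeff_freqVec, smul_zero, sub_zero]

end Dictionary

end Summit.NavierStokesRegularity.FluidComputer.TransportGalerkinFourierDictionary

end
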